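import Summits.QuantumFields.YangMills.Theorems.BalabanUVNodesN15KingModelCurvedHTorusHolder

/-!
# BalabanUVNodes ∕ N15 — THE KING-MODEL RUNG, PART 52: KING's PROPOSITION 3.8 (3.71) IN THE SCHEMA's LETTERS WITH THE HÖLDER EXPONENT
# QUANTIFIED FIRST (`Prop38PrintedAt α`), ITS BRIDGE TO `SlicePropagator.Prop38Printed`, AND THE `A = 0` INHABITANT — all four lines for
# King's actual minimisers on Bałaban's volumes, uniformly, for every `α ∈ (0, 1)`
# (Track A, DAG node N15 = NE2, row s3 «King-model rung»; key K3⁷ `SpineGivenEndpointR13SepCoPH` stmt-QuantumFields-20544, helper; FILE 2 of 2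
# over PART 51 `…N15KingModelCurvedHTorusHolder`)

HONEST FRAMING.  Count-neutral kernel bookkeeping (`--kind proof --supports stmt-QuantumFields-20544 --as helper`; cell `pub-ymgap`, seat
`pub-ymgap-dag-n15-d` g16; n15-e GO on its located item (t2″)).  King's `A = 0` SCALAR MODEL ([King1986], template literature, printed AND
kernel-proved; PART 51 assembled the four lines of (3.71) for the point-distance datum `kingTwoSpacingH`).  NOT [Ba 4] at `A ≠ 0`, NOT
Bałaban's `H_k(U)`; NE2⁺ NOT PRINTED; N15 NOT discharged; K3⁷ OPEN, not claimed; counts UNMOVED (typed 28∕28 · discharged 5∕27, A 5∕28);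
finite tori — nothing continuum ∕ ℝ⁴ ∕ OS ∕ mass-gap ∕ Clay.  0 `sorry`, standard axioms; ONE `def`: the mirror predicate `Prop38PrintedAt`,
which is THIS SEAT's (a reading aid next to the typer's schema), NOT a declaration of the literature cell `lit-balaban` and NOT a re-typing
of its file `King1986/SlicePropagatorStatements` (that file is untouched; a v1.1 with `α` an argument is the typer's call).

WHAT.
* **`Prop38PrintedAt α T C δ₀ γ`** — the text of `SlicePropagator.Prop38Printed T C δ₀ γ` (`SlicePropagatorStatements` :216–231, King p. 664
  verbatim) with the Hölder exponent `α` a PARAMETER instead of the inner `∀ α ∈ (0, 1)`; `prop38PrintedAt_of_prop38Printed` and the bridge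
  ★ `prop38Printed_iff_forall`: `Prop38Printed T C δ₀ γ ↔ ∀ α ∈ (0, 1), Prop38PrintedAt α T C δ₀ γ` — so the schema AS TYPED asks ONE
  `(C, δ₀, γ)` to serve ALL `α` at once.
* ★★★ **`prop38PrintedAt_kingTwoSpacingH`**: for odd `L ≥ 3`, `a, m² > 0` and EVERY `0 < α < 1` there are `C, δ₀, γ > 0` (`γ = (1 − α)∕4`)
  with `Prop38PrintedAt α (kingTwoSpacingH L a m² j n) C δ₀ γ` for EVERY volume∕scale index `j` and EVERY `n ≥ 1` — Prop. 3.8 (3.71), all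
  four lines, for King's actual `A = 0` minimisers, uniformly, in King's quantifier order «for 0 < α < 1, and γ sufficiently small»
  (PART 51's `line1…line4_kingTwoSpacingH` at the inner exponent `γ₀ = (1 − α)∕2`, `C = max`, `δ₀ = min`); `kingTwoSpacingH_family_nonempty`.
LOCATED (schema reading, not mathematics; first noted by n15-e, INTENT-6 of 2026-08-27 and HANDOFF (t2″)): `Prop38Printed T C δ₀ γ` puts
`∀ α ∈ (0, 1)` INSIDE the fixed `(C, δ₀, γ)`.  King (p. 664) chooses `γ` after `α`; the tree's `A = 0` theorems carry the coupling
`α + γ ≤ 1` (`MinimizerHolderDecay.king_prop38_holder_torus_blocks`); and in the model the two-spacing gain of the Hölder quotient at the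
finest separations is the complementary exponent `1 − α` (heuristic: for `|x′ − y′| ≈ 2η` over `|x − y| = η` the quotient difference is
`≈ (2^{1−α} − 1)η^{1−α}·∂ℋ = O(L^{−(1−α)K})` with `∂ℋ = O(1)`), so no single `(C, δ₀, γ > 0)` is expected to serve all `α` uniformly in
`K`: the family-uniform by-name inhabitant of `Prop38Printed` is NOT claimed for King's model (and not expected to exist); with `α` an
argument of the schema, `prop38PrintedAt_kingTwoSpacingH` IS that inhabitant.  Consumers of lines 1–2 are unaffected.
Locators: [King1986] C. King, CMP **102** (1986) 649–677: (3.62) p. 663, Prop. 3.8 (3.71) p. 664, §4 pp. 673–674.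
-/

noncomputable section

namespace Summit.QuantumFields.YangMills.BalabanUVNodes.N15.KingModel

open Literature.MathematicalPhysics.QuantumFieldTheory.King1986.Torus (holdist_nonneg)
open Literature.MathematicalPhysics.QuantumFieldTheory.King1986.SlicePropagator (TwoSpacing Prop38Printed holderDeriv)
open Summit.QuantumFields.YangMills.BalabanUVNodes.N15KingModelRung (KingVolIndex kingVol kingVol_neZero)

variable {d : ℕ}

/-! ## §5 The schema's (3.71) with the Hölder exponent quantified FIRST, and King's `A = 0` inhabitant of it -/

section Schema

/-- **PROPOSITION 3.8 (3.71) AT A FIXED HÖLDER EXPONENT** — the text of the literature schema `SlicePropagator.Prop38Printed T C δ₀ γ`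
(`King1986/SlicePropagatorStatements`, verbatim from p. 664) with `α` a PARAMETER of the predicate instead of the inner `∀ α ∈ (0, 1)`:
King's quantifier order «for 0 < α < 1, and γ sufficiently small» (γ chosen after α).  Lines 1–2 (kernel and lattice derivative)
are α-free; lines 3–4 are the two-spacing rates of the Hölder quotients (3.62) at THIS `α`.  `Prop38Printed T C δ₀ γ` is exactly
`∀ α ∈ (0, 1), Prop38PrintedAt α T C δ₀ γ` (`prop38Printed_iff_forall`). [cite: King1986, Prop. 3.8 (3.71) p.664] -/
def Prop38PrintedAt {d : ℕ} (α : ℝ) (T : TwoSpacing d) (C δ₀ γ : ℝ) : Prop :=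
  (∀ (x' : T.hi.S) (z : T.lo.S), T.IsUnit z →
    |T.K' x' z - T.K (T.pt x') z| ≤ C * (T.lo.L : ℝ) ^ (-(γ * T.lo.k)) * Real.exp (-(δ₀ * T.lo.dist (T.pt x') z)) ∧
    ∀ μ : Fin d, |T.dK' μ x' z - T.dK μ (T.pt x') z|
      ≤ C * (T.lo.L : ℝ) ^ (-(γ * T.lo.k)) * Real.exp (-(δ₀ * T.lo.dist (T.pt x') z))) ∧
  (∀ (x' y' : T.hi.S) (z : T.lo.S), T.IsUnit z → 0 < T.hi.dist x' y' →
    0 < T.lo.dist (T.pt x') (T.pt y') →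
    |holderDeriv T.hi.dist α T.K' x' y' z - holderDeriv T.lo.dist α T.K (T.pt x') (T.pt y') z|
        ≤ C * (T.lo.L : ℝ) ^ (-(γ * T.lo.k))
          * Real.exp (-(δ₀ * min (T.lo.dist (T.pt x') z) (T.lo.dist (T.pt y') z))) ∧
    ∀ μ : Fin d, |holderDeriv T.hi.dist α (T.dK' μ) x' y' z - holderDeriv T.lo.dist α (T.dK μ) (T.pt x') (T.pt y') z|
        ≤ C * (T.lo.L : ℝ) ^ (-(γ * T.lo.k))
          * Real.exp (-(δ₀ * min (T.lo.dist (T.pt x') z) (T.lo.dist (T.pt y') z))))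

/-- From the schema as typed to every fixed exponent: `Prop38Printed T C δ₀ γ → Prop38PrintedAt α T C δ₀ γ` (`0 < α < 1`). [cite: King1986, Prop. 3.8 (3.71) p.664] -/
theorem prop38PrintedAt_of_prop38Printed {d : ℕ} {T : TwoSpacing d} {C δ₀ γ : ℝ} (h : Prop38Printed T C δ₀ γ) {α : ℝ}
    (hα0 : 0 < α) (hα1 : α < 1) : Prop38PrintedAt α T C δ₀ γ :=
  ⟨h.1, h.2 α hα0 hα1⟩

/-- **The schema as typed IS the conjunction of its fixed-exponent forms**: `Prop38Printed T C δ₀ γ ↔ ∀ α ∈ (0, 1), Prop38PrintedAt α T C δ₀ γ`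
(lines 1–2 are read at `α = ½`).  So the by-name inhabitant of `Prop38Printed` for a family of data asks for ONE `(C, δ₀, γ)` serving ALL
`α` at once — stronger than King's «γ sufficiently small» given `α`. [cite: King1986, Prop. 3.8 (3.71) p.664] -/
theorem prop38Printed_iff_forall {d : ℕ} (T : TwoSpacing d) (C δ₀ γ : ℝ) :
    Prop38Printed T C δ₀ γ ↔ ∀ α : ℝ, 0 < α → α < 1 → Prop38PrintedAt α T C δ₀ γ := by
  refine ⟨fun h α hα0 hα1 => prop38PrintedAt_of_prop38Printed h hα0 hα1, fun h => ⟨(h (1 / 2) one_half_pos one_half_lt_one).1, ?_⟩⟩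
  intro α hα0 hα1
  exact (h α hα0 hα1).2

variable (L : ℕ) [NeZero L]

/-- ★★★ **KING's PROPOSITION 3.8 (3.71), ALL FOUR LINES, FOR THE `A = 0` MINIMISERS ON BAŁABAN's VOLUMES — UNIFORMLY, IN KING's QUANTIFIER
ORDER.**  For odd `L ≥ 3`, `a > 0`, `m² > 0` and every Hölder exponent `0 < α < 1` there are `C, δ₀, γ > 0` (functions of
`d, L, a, m², α`; `γ = (1 − α)∕4`) such that `Prop38PrintedAt α (kingTwoSpacingH L a m² j n) C δ₀ γ` for EVERY volume∕scale index `j`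
(unit torus `2L^m`, `K ≥ 1` coarse scales) and EVERY `n ≥ 1`: the two-spacing rates `C·L^{−γK}e^{−δ₀|x − z|}` of `ℋ = a_kG^η_kQ^*_k`,
of its lattice gradient, and of the Hölder quotients `∂_α(x, y)` of both, `e^{−δ₀·dist({x, y}, z)}`, at all unit sites `z` and fine
points over them.  Assembly: lines 1–2 at the inner exponent `γ₀ = (1 − α)∕2` (`line1_∕line2_kingTwoSpacingH`), lines 3–4 at
`(α, γ₀)` (`α + γ₀ < 1`; `line3_∕line4_kingTwoSpacingH`), `C = max`, `δ₀ = min`, `γ = γ₀∕2`.  King's `A = 0` MODEL — NOT [Ba 4] at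
`A ≠ 0`, NOT Bałaban's `H_k(U)`. [cite: King1986, Prop. 3.8 (3.71) p.664, §4 pp.673–674] -/
theorem prop38PrintedAt_kingTwoSpacingH (hLodd : Odd L) (hL : 2 ≤ L) {a m2 : ℝ} (ha : 0 < a) (hm : 0 < m2) {α : ℝ} (hα0 : 0 < α)
    (hα1 : α < 1) :
    ∃ C δ₀ γ : ℝ, 0 < C ∧ 0 < δ₀ ∧ 0 < γ ∧ ∀ (j : KingVolIndex d) (n : ℕ) (_hn : 1 ≤ n),
      Prop38PrintedAt α (kingTwoSpacingH L a m2 j n) C δ₀ γ := by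
  set γ₀ : ℝ := (1 - α) / 2 with hγ₀
  have hγ₀0 : 0 < γ₀ := by rw [hγ₀]; linarith
  have hγ₀1 : γ₀ < 1 := by rw [hγ₀]; linarith
  have hαγ : α + γ₀ < 1 := by rw [hγ₀]; linarith
  obtain ⟨C₁, δ₁, hC₁, hδ₁, H₁⟩ := line1_kingTwoSpacingH (d := d) L hLodd hL ha hm hγ₀0.le hγ₀1.le
  obtain ⟨C₂, δ₂, hC₂, hδ₂, H₂⟩ := line2_kingTwoSpacingH (d := d) L hLodd hL ha hm hγ₀0.le hγ₀1
  obtain ⟨C₃, δ₃, hC₃, hδ₃, H₃⟩ := line3_kingTwoSpacingH (d := d) L hLodd hL ha hm hα0 hγ₀0 hαγ.le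
  obtain ⟨C₄, δ₄, hC₄, hδ₄, H₄⟩ := line4_kingTwoSpacingH (d := d) L hLodd hL ha hm hα0 hγ₀0 hαγ
  set C : ℝ := max (max C₁ C₂) (max C₃ C₄) with hCdef
  set δ : ℝ := min (min δ₁ δ₂) (min δ₃ δ₄) with hδdef
  have hC1 : C₁ ≤ C := (le_max_left _ _).trans (le_max_left _ _)
  have hC2 : C₂ ≤ C := (le_max_right _ _).trans (le_max_left _ _)
  have hC3 : C₃ ≤ C := (le_max_left _ _).trans (le_max_right _ _)
  have hC4 : C₄ ≤ C := (le_max_right _ _).trans (le_max_right _ _)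
  have hd1 : δ ≤ δ₁ := (min_le_left _ _).trans (min_le_left _ _)
  have hd2 : δ ≤ δ₂ := (min_le_left _ _).trans (min_le_right _ _)
  have hd3 : δ ≤ δ₃ := (min_le_right _ _).trans (min_le_left _ _)
  have hd4 : δ ≤ δ₄ := (min_le_right _ _).trans (min_le_right _ _)
  have hδ : 0 < δ := lt_min (lt_min hδ₁ hδ₂) (lt_min hδ₃ hδ₄)
  have hCpos : 0 < C := hC₁.trans_le hC1
  refine ⟨C, δ, γ₀ / 2, hCpos, hδ, half_pos hγ₀0, fun j n hn => ?_⟩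
  haveI := kingVol_neZero L j
  -- the generic weakening step: `Cᵢ·r·e^{−δᵢt} ≤ C·r·e^{−δt}` for `t ≥ 0`, `r ≥ 0`
  have weaken : ∀ {Ci δi r t X : ℝ}, Ci ≤ C → δ ≤ δi → 0 ≤ r → 0 ≤ t →
      X ≤ Ci * r * Real.exp (-(δi * t)) → X ≤ C * r * Real.exp (-(δ * t)) := by
    intro Ci δi r t X hCi hδi hr ht hX
    refine hX.trans ?_
    have he : Real.exp (-(δi * t)) ≤ Real.exp (-(δ * t)) :=
      Real.exp_le_exp.mpr (neg_le_neg (mul_le_mul_of_nonneg_right hδi ht))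
    calc Ci * r * Real.exp (-(δi * t)) ≤ C * r * Real.exp (-(δi * t)) :=
          mul_le_mul_of_nonneg_right (mul_le_mul_of_nonneg_right hCi hr) (Real.exp_pos _).le
      _ ≤ C * r * Real.exp (-(δ * t)) := mul_le_mul_of_nonneg_left he (mul_nonneg hCpos.le hr)
  have hr : 0 ≤ ((kingTwoSpacingH L a m2 j n).lo.L : ℝ) ^ (-(γ₀ / 2 * (kingTwoSpacingH L a m2 j n).lo.k)) :=
    Real.rpow_nonneg (Nat.cast_nonneg _) _
  have hdist : ∀ u z : (kingTwoSpacingH L a m2 j n).lo.S, 0 ≤ (kingTwoSpacingH L a m2 j n).lo.dist u z :=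
    fun u z => holdist_nonneg (L ^ j.K) (kingVol L j) u z
  refine ⟨fun x' z _ => ⟨?_, fun μ => ?_⟩, fun x' y' z _ _ _ => ⟨?_, fun μ => ?_⟩⟩
  · exact weaken hC1 hd1 hr (hdist _ _) (H₁ j n hn x' z)
  · exact weaken hC2 hd2 hr (hdist _ _) (H₂ j n hn x' z μ)
  · exact weaken hC3 hd3 hr (le_min (hdist _ _) (hdist _ _)) (H₃ j n hn x' y' z)
  · exact weaken hC4 hd4 hr (le_min (hdist _ _) (hdist _ _)) (H₄ j n hn x' y' z μ)

/-- The index class is non-empty and every member is a genuine two-spacing pair (`n ≥ 1` over a volume with `K ≥ 1` coarse scales):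
the family quantified in `prop38PrintedAt_kingTwoSpacingH` is not void. [folklore] -/
theorem kingTwoSpacingH_family_nonempty (d : ℕ) : ∃ (j : KingVolIndex d) (n : ℕ), 1 ≤ n ∧ 1 ≤ j.K :=
  ⟨⟨0, 1, le_rfl, 1, le_rfl⟩, 1, le_rfl, le_rfl⟩

end Schema

end Summit.QuantumFields.YangMills.BalabanUVNodes.N15.KingModel

end
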